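import Summits.PneNP.PneNP.Theorems.ExpanderLinearGeneratorsResolutionNFreePiCount
import Literature.Probability.Independence.LovaszLocalLemma
import HarnessLib

/-!
# The n-free resolution-size rung for expanding linear systems, XVI: the local-lemma master inequality

Support file for crux `stmt-PneNP-11442`
(`Summit.PneNP.PneNP.Theses.ExpanderLinearGenerators.ExpansionForcesDepthFregeSize`, the
EXPANSION-SCALE LAW, uniform in the numbers `n` of variables and `m` of rows). Files IX–XII
proved the n-free, m-free EXPONENTIAL resolution-size law at bounded column weight (Theorem C,
`resolution_size_nfree_column`) by an ALTERED load-bounded random restriction and a union bound;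
the alteration costs a factor in the admissible column weight: `Δ ≤ r^{(1-ε)ℓ/2 - 1}/2^ℓ`. This
file replaces the union bound by the LOVÁSZ LOCAL LEMMA (variable version,
`Literature.Probability.Independence.exists_forall_not_mem_of_variable`) and needs no alteration:

* sample `ω : Fin n → Fin (K+1) × Bool` uniformly; the restriction `ρ_ω` assigns `(ω v).2` to the
  variables `v < n` with `(ω v).1 = 0` (rate `1/(K+1)`) and `false` above `n`;
* bad events: a row is OVERLOADED (`> L` of its `≤ ℓ` variables assigned; probability
  `≤ 2^ℓ/(K+1)^{L+1}`, file XV), a line of the refutation is ALIVE AND WIDE (not satisfied,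
  `> W` free literals; probability `≤ ((2K+1)/(2K+2))^{v}` for a line on `v > W/2` variables,
  file XV); each event is determined by the coordinates of its row / line, a row meets `≤ ℓ Δ`
  rows and a line on `v` variables meets `≤ v Δ` rows (column weight `≤ Δ`);
* with `x_row = 1/(4(ℓ+1)(K+1)Δ)` and `x_line = 1/(2|π|)` the local lemma applies as soon as
  `16 (ℓ+1) Δ 2^ℓ ≤ (K+1)^L` and `4 |π| ((4K+2)/(4K+3))^{W/2+1} ≤ 1`, and produces a restriction
  with all loads `≤ L` killing every wide line — contradicting the deterministic core of file I
  (`exists_unsatisfied_wide_line`, relative Ben-Sasson–Wigderson width).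

Main result `one_lt_length_mul_lll`: `1 < 4 |π| ((4K+2)/(4K+3))^{W/2+1}` whenever
`16 (ℓ+1) Δ 2^ℓ ≤ (K+1)^L`, `L < c`, `W < (c - L) r / 2`. File XVII turns it into the law
`|π| ≥ 2^{r^ε/112 - 2}` for `Δ ≤ r^{(1-ε)(⌈3ℓ/4⌉-1)}/((ℓ+1) 2^{ℓ+4})` (Theorem C′).

References: P. Erdős, L. Lovász (1975); N. Alon, J. Spencer, *The Probabilistic Method*, Ch. 5;
E. Ben-Sasson, A. Wigderson, J. ACM 48 (2001), §3, Thm. 6.5; P. Beame, T. Pitassi, FOCS 1996;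
J. Krajíček, *Proof complexity* (CUP 2019), §13.4, Problem 19.4.5.
-/

namespace Summit.PneNP.PneNP.Theorems.ResNFree

set_option linter.dupNamespace false -- `Summit.PneNP.PneNP.…`: summit = sub-problem (D-0017)

open Finset Literature.Computability.Complexity Literature.Computability.MetaComplexity
open Summit.PneNP.PneNP.Theorems.ResKRestriction
open Literature.Probability.Independence (exists_forall_not_mem_of_variable)

variable {m n : ℕ}

set_option maxHeartbeats 400000 in
/-- **The local-lemma master inequality of the load-bounded restriction method (n-free,
m-free, no alteration).** Let the row supports of `E` have size `≤ ℓ` and form an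
`(r, c)`-boundary expander (`r ≥ 2`), let every variable lie in at most `Δ ≥ 1` rows, and let
`L < c`, `W < (c - L) r / 2` and `K` satisfy `16 (ℓ+1) Δ 2^ℓ ≤ (K+1)^L`. Then every resolution
refutation `π` of `sumEncoding 1 E` satisfies `1 < 4 |π| ((4K+2)/(4K+3))^{W/2+1}`. Proof: if
not, the variable version of the Lovász Local Lemma, applied to the overload events of the rows
(`x = 1/(4(ℓ+1)(K+1)Δ)`) and the alive-and-wide events of the lines (`x = 1/(2|π|)`) under a
uniform sample `ω : Fin n → Fin (K+1) × Bool`, yields a restriction with all loads `≤ L` that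
kills every wide line of `π`, contradicting `exists_unsatisfied_wide_line`.
[Erdős–Lovász 1975; Alon–Spencer, Lemma 5.1.1; Beame–Pitassi 1996; Ben-Sasson–Wigderson 2001,
Thm. 6.5] [folklore] -/
theorem one_lt_length_mul_lll (E : Fin m → LinEqMod 2 n) {r c : ℝ}
    (hexp : IsBoundaryExpander (rowVars E) r c) (hr : 2 ≤ r) {ℓ L W Δ : ℕ} (K : ℕ)
    (hsparse : ∀ i, (E i).supp.card ≤ ℓ)
    (hcol : ∀ j : Fin n, ((univ : Finset (Fin m)).filter fun i => j ∈ (E i).supp).card ≤ Δ)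
    (hΔ : 1 ≤ Δ) (hcL : (L : ℝ) < c) (hW : (W : ℝ) < (c - L) * r / 2)
    (hK : 16 * ((ℓ : ℝ) + 1) * Δ * 2 ^ ℓ ≤ ((K : ℝ) + 1) ^ L)
    {π : List (ResLine ℕ)} (hπ : IsResRefutation (sumEncoding 1 E) π) :
    1 < 4 * (π.length : ℝ) * ((4 * (K : ℝ) + 2) / (4 * K + 3)) ^ (W / 2 + 1) := by
  classical
  by_contra hle
  push Not at hle
  /- 1. Numerical preliminaries (small context). -/
  have hm : 0 < m := pos_of_isResRefutation E hπ
  have hSpos : 0 < π.length := by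
    obtain ⟨l, hl, -⟩ := hπ.2
    exact List.length_pos_of_mem hl
  obtain ⟨S, hSdef⟩ : ∃ S : ℕ, S = π.length := ⟨_, rfl⟩
  rw [← hSdef] at hle
  have hS1 : (1 : ℝ) ≤ S := by rw [hSdef]; exact_mod_cast hSpos
  have hS0 : (0 : ℝ) < S := by linarith
  have hK0 : (0 : ℝ) < (K : ℝ) + 1 := by positivity
  have hK1 : (1 : ℝ) ≤ (K : ℝ) + 1 := by linarith [Nat.cast_nonneg (α := ℝ) K]
  have hℓ1 : (1 : ℝ) ≤ (ℓ : ℝ) + 1 := by linarith [Nat.cast_nonneg (α := ℝ) ℓ]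
  have hΔ0 : (0 : ℝ) < Δ := by exact_mod_cast hΔ
  have hΔ1 : (1 : ℝ) ≤ Δ := by exact_mod_cast hΔ
  -- the weights `xR = 1/(4(ℓ+1)(K+1)Δ)` of rows and `xL = 1/(2S)` of lines
  obtain ⟨xR, hxR⟩ : ∃ t : ℝ, t = 1 / (4 * ((ℓ : ℝ) + 1) * ((K : ℝ) + 1) * Δ) := ⟨_, rfl⟩
  obtain ⟨xL, hxL⟩ : ∃ t : ℝ, t = 1 / (2 * (S : ℝ)) := ⟨_, rfl⟩
  have hden1 : (1 : ℝ) ≤ ((ℓ : ℝ) + 1) * ((K : ℝ) + 1) * Δ :=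
    one_le_mul_of_one_le_of_one_le (one_le_mul_of_one_le_of_one_le hℓ1 hK1) hΔ1
  have hden : 0 < 4 * ((ℓ : ℝ) + 1) * ((K : ℝ) + 1) * Δ := by positivity
  have hxR0 : 0 < xR := by rw [hxR]; positivity
  have hxR1 : xR ≤ 1 / 4 := by
    rw [hxR, div_le_div_iff₀ hden (by norm_num)]
    nlinarith [hden1]
  have hxL0 : 0 < xL := by rw [hxL]; positivity
  have hxL1 : xL ≤ 1 / 2 := by
    rw [hxL, div_le_div_iff₀ (by positivity) (by norm_num)]; linarith
  have h1xR : 0 ≤ 1 - xR := by linarith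
  have h1xL : 0 ≤ 1 - xL := by linarith
  -- Bernoulli
  have hbern : ∀ (y : ℝ) (t : ℕ), y ≤ 1 → 1 - (t : ℝ) * y ≤ (1 - y) ^ t := by
    intro y t hy
    have h := one_add_mul_le_pow (a := -y) (by linarith) t
    have h4 : (1 : ℝ) + (-y) = 1 - y := by ring
    rw [h4] at h
    linarith
  -- `(1 - xL)^S ≥ 1/2`
  have hxLS : (1 : ℝ) / 2 ≤ (1 - xL) ^ S := by
    refine le_trans ?_ (hbern xL S (by linarith))
    have h3 : (S : ℝ) * xL = 1 / 2 := by rw [hxL]; field_simp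
    linarith
  -- `(1 - xR)^{ℓ Δ} ≥ 3/4`
  have hrow34 : (3 : ℝ) / 4 ≤ (1 - xR) ^ (ℓ * Δ) := by
    refine le_trans ?_ (hbern xR (ℓ * Δ) (by linarith))
    have h1 : ((ℓ * Δ : ℕ) : ℝ) * xR = (ℓ : ℝ) / (4 * ((ℓ : ℝ) + 1) * ((K : ℝ) + 1)) := by
      rw [hxR]; push_cast; field_simp
    rw [h1]
    have h2 : (ℓ : ℝ) / (4 * ((ℓ : ℝ) + 1) * ((K : ℝ) + 1)) ≤ 1 / 4 := by
      rw [div_le_div_iff₀ (by positivity) (by norm_num)]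
      nlinarith [Nat.cast_nonneg (α := ℝ) ℓ, hK1]
    linarith
  -- `b = (4K+3)/(4K+4) ≤ (1 - xR)^Δ`
  obtain ⟨b, hb⟩ : ∃ t : ℝ, t = (4 * (K : ℝ) + 3) / (4 * K + 4) := ⟨_, rfl⟩
  have hb0 : 0 < b := by rw [hb]; positivity
  have hbΔ : b ≤ (1 - xR) ^ Δ := by
    refine le_trans ?_ (hbern xR Δ (by linarith))
    have h1 : (Δ : ℝ) * xR = 1 / (4 * ((ℓ : ℝ) + 1) * ((K : ℝ) + 1)) := by
      rw [hxR]; field_simp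
    rw [h1, hb]
    have h2 : (1 : ℝ) / (4 * ((ℓ : ℝ) + 1) * ((K : ℝ) + 1)) ≤ 1 / (4 * (K : ℝ) + 4) := by
      rw [div_le_div_iff₀ (by positivity) (by positivity), one_mul, one_mul]
      nlinarith [Nat.cast_nonneg (α := ℝ) ℓ, hK0]
    have h3 : (4 * (K : ℝ) + 3) / (4 * K + 4) = 1 - 1 / (4 * (K : ℝ) + 4) := by
      field_simp; ring
    rw [h3]
    linarith
  -- rows: `2^ℓ ≤ (3/8) xR (K+1)^{L+1}`
  have hKL : 0 < ((K : ℝ) + 1) ^ (L + 1) := by positivity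
  have hkey : (2 : ℝ) ^ ℓ ≤ 3 / 8 * xR * ((K : ℝ) + 1) ^ (L + 1) := by
    have h1 : 3 / 8 * xR * ((K : ℝ) + 1) ^ (L + 1)
        = 3 * ((K : ℝ) + 1) ^ L / (32 * ((ℓ : ℝ) + 1) * Δ) := by
      rw [hxR, pow_succ]; field_simp; ring
    rw [h1, le_div_iff₀ (by positivity)]
    linarith [hK, pow_nonneg hK0.le L]
  -- lines: `a^v ≤ xL · b^v / 2` for `v ≥ W/2 + 1`, where `a = (2K+1)/(2K+2) = q₀ b`
  have hline : ∀ v : ℕ, W / 2 + 1 ≤ v →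
      ((2 * (K : ℝ) + 1) / (2 * K + 2)) ^ v ≤ xL * (b ^ v * (1 / 2)) := by
    intro v hvq
    obtain ⟨q₀, hq₀⟩ : ∃ t : ℝ, t = (4 * (K : ℝ) + 2) / (4 * K + 3) := ⟨_, rfl⟩
    rw [← hq₀] at hle
    have hq₀0 : 0 ≤ q₀ := by rw [hq₀]; positivity
    have hq₀1 : q₀ ≤ 1 := by
      rw [hq₀, div_le_one (by positivity)]; linarith
    have h2K : (2 * (K : ℝ) + 2) ≠ 0 := by positivity
    have h4K3 : (4 * (K : ℝ) + 3) ≠ 0 := by positivity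
    have h4K4 : (4 * (K : ℝ) + 4) ≠ 0 := by positivity
    have haqb : (2 * (K : ℝ) + 1) / (2 * K + 2) = q₀ * b := by
      rw [hq₀, hb, div_mul_div_comm, div_eq_div_iff h2K (mul_ne_zero h4K3 h4K4)]
      ring
    have hq₀v : 4 * (S : ℝ) * q₀ ^ v ≤ 1 :=
      le_trans (mul_le_mul_of_nonneg_left (pow_le_pow_of_le_one hq₀0 hq₀1 hvq)
        (by positivity)) hle
    have h14S : q₀ ^ v ≤ 1 / (4 * S) := by
      rw [le_div_iff₀ (by positivity)]; linarith [hq₀v]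
    rw [haqb, mul_pow]
    have h1 : xL * (b ^ v * (1 / 2)) = (1 / (4 * S)) * b ^ v := by rw [hxL]; ring
    rw [h1]
    exact mul_le_mul_of_nonneg_right h14S (pow_nonneg hb0.le v)
  /- 2. The sample space, restrictions, variables of a clause. -/
  haveI : Nonempty (Fin m) := ⟨⟨0, hm⟩⟩
  obtain ⟨N, hNdef⟩ : ∃ t : ℝ, t = (Fintype.card (Fin n → Fin (K + 1) × Bool) : ℝ) := ⟨_, rfl⟩
  have hNpos : 0 < N := by rw [hNdef]; exact_mod_cast Fintype.card_pos
  set ρ : (Fin n → Fin (K + 1) × Bool) → ℕ → Option Bool := fun ω v =>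
    if h : v < n then (if (ω ⟨v, h⟩).1 = 0 then some (ω ⟨v, h⟩).2 else none) else some false
    with hρ
  set Vars : Finset (Literal ℕ) → Finset (Fin n) := fun C =>
    univ.filter fun j : Fin n => ((j : ℕ), true) ∈ C ∨ ((j : ℕ), false) ∈ C with hVars
  have hρ_out : ∀ ω v, ¬ v < n → ρ ω v ≠ none := by
    intro ω v hv
    simp only [hρ, hv, ↓reduceDIte, ne_eq, reduceCtorEq, not_false_eq_true]
  have hρ_agree : ∀ (ω ω' : Fin n → Fin (K + 1) × Bool) (C : Finset (Literal ℕ)),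
      (∀ j ∈ Vars C, ω j = ω' j) → ∀ l ∈ C, ρ ω l.1 = ρ ω' l.1 := by
    intro ω ω' C hag l hl
    by_cases hv : l.1 < n
    · have hjV : (⟨l.1, hv⟩ : Fin n) ∈ Vars C := by
        refine mem_filter.2 ⟨mem_univ _, ?_⟩
        rcases hb : l.2 with _ | _
        · right; have : l = (l.1, false) := by ext <;> simp [hb]
          rw [← this]; exact hl
        · left; have : l = (l.1, true) := by ext <;> simp [hb]
          rw [← this]; exact hl
      have heq := hag _ hjV
      simp only [hρ, hv, ↓reduceDIte, heq]
    · simp only [hρ, hv, ↓reduceDIte]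
  /- 3. Events, their variables and weights, indexed by rows ⊕ lines. -/
  set A : Fin m ⊕ ResLine ℕ → Finset (Fin n → Fin (K + 1) × Bool) := Sum.elim
    (fun k => univ.filter fun ω => L + 1 ≤ ((E k).supp.filter fun j => (ω j).1 = 0).card)
    (fun l => univ.filter fun ω =>
      ¬ SatisfiedBy (ρ ω) l.clause ∧ W < (restrictClause (ρ ω) l.clause).card) with hA
  set vbl : Fin m ⊕ ResLine ℕ → Finset (Fin n) := Sum.elim (fun k => (E k).supp)
    (fun l => Vars l.clause) with hvbl
  set x : Fin m ⊕ ResLine ℕ → ℝ := Sum.elim (fun _ => xR) (fun _ => xL) with hx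
  set I : Finset (Fin m ⊕ ResLine ℕ) := (univ : Finset (Fin m)).disjSum π.toFinset with hI
  -- their defining properties (after which the definitions are frozen)
  have hmemAl : ∀ k ω, ω ∈ A (Sum.inl k) ↔
      L + 1 ≤ ((E k).supp.filter fun j => (ω j).1 = 0).card := by
    intro k ω; simp only [hA, Sum.elim_inl, mem_filter, mem_univ, true_and]
  have hmemAr : ∀ l ω, ω ∈ A (Sum.inr l) ↔
      ¬ SatisfiedBy (ρ ω) l.clause ∧ W < (restrictClause (ρ ω) l.clause).card := by
    intro l ω; simp only [hA, Sum.elim_inr, mem_filter, mem_univ, true_and]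
  have hvl : ∀ k, vbl (Sum.inl k) = (E k).supp := fun k => rfl
  have hvr : ∀ l, vbl (Sum.inr l) = Vars l.clause := fun l => rfl
  have hxl : ∀ k, x (Sum.inl k) = xR := fun k => rfl
  have hxr : ∀ l, x (Sum.inr l) = xL := fun l => rfl
  have hIl : ∀ k, Sum.inl k ∈ I := fun k => by
    rw [hI, Finset.inl_mem_disjSum]; exact mem_univ _
  have hIr : ∀ l, Sum.inr l ∈ I ↔ l ∈ π := fun l => by
    rw [hI, Finset.inr_mem_disjSum, List.mem_toFinset]
  clear_value A vbl x I
  have hx0 : ∀ i, 0 ≤ x i := by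
    rintro (k | l)
    · rw [hxl]; exact hxR0.le
    · rw [hxr]; exact hxL0.le
  have hx1 : ∀ i, x i ≤ 1 := by
    rintro (k | l)
    · rw [hxl]; linarith
    · rw [hxr]; linarith
  have hxI : ∀ i ∈ I, x i < 1 := by
    rintro (k | l) -
    · rw [hxl]; linarith
    · rw [hxr]; linarith
  -- the events are determined by their variables
  have hdet : ∀ i ∈ I, ∀ ω ω' : Fin n → Fin (K + 1) × Bool,
      (∀ v ∈ vbl i, ω v = ω' v) → ω ∈ A i → ω' ∈ A i := by
    rintro (k | l) - ω ω' hag hω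
    · rw [hvl] at hag
      rw [hmemAl] at hω ⊢
      have heq : ((E k).supp.filter fun j => (ω' j).1 = 0)
          = ((E k).supp.filter fun j => (ω j).1 = 0) :=
        filter_congr fun j hj => by rw [hag j hj]
      rw [heq]; exact hω
    · rw [hvr] at hag
      rw [hmemAr] at hω ⊢
      have hl := hρ_agree ω ω' l.clause hag
      rw [← satisfiedBy_congr hl, ← restrictClause_congr hl]
      exact hω
  -- rows meeting a set of variables
  have hrows : ∀ T : Finset (Fin n),
      ((univ : Finset (Fin m)).filter fun k => ¬ Disjoint T (E k).supp).card ≤ T.card * Δ := by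
    intro T
    have hsub : ((univ : Finset (Fin m)).filter fun k => ¬ Disjoint T (E k).supp)
        ⊆ T.biUnion fun j => univ.filter fun k => j ∈ (E k).supp := by
      intro k hk
      have hk' := (mem_filter.1 hk).2
      obtain ⟨j, hjT, hjk⟩ := not_disjoint_iff.1 hk'
      exact mem_biUnion.2 ⟨j, hjT, mem_filter.2 ⟨mem_univ _, hjk⟩⟩
    calc _ ≤ (T.biUnion fun j => univ.filter fun k => j ∈ (E k).supp).card := card_le_card hsub
      _ ≤ ∑ j ∈ T, (univ.filter fun k => j ∈ (E k).supp).card := card_biUnion_le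
      _ ≤ ∑ j ∈ T, Δ := sum_le_sum fun j _ => hcol j
      _ = T.card * Δ := by rw [sum_const, smul_eq_mul]
  -- the neighbour product of an event on the variables `vbl i`
  have hprod : ∀ i ∈ I,
      (1 - xR) ^ ((vbl i).card * Δ) * (1 / 2)
        ≤ ∏ j ∈ I.filter (fun j => j ≠ i ∧ ¬ Disjoint (vbl i) (vbl j)), (1 - x j) := by
    intro i hi
    obtain ⟨Rw, hRw⟩ : ∃ T : Finset (Fin m),
        T = univ.filter fun k => ¬ Disjoint (vbl i) (E k).supp := ⟨_, rfl⟩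
    have hsubG : I.filter (fun j => j ≠ i ∧ ¬ Disjoint (vbl i) (vbl j))
        ⊆ Rw.disjSum π.toFinset := by
      intro j hj
      obtain ⟨hjI, -, hdj⟩ := mem_filter.1 hj
      rcases j with k | l
      · rw [Finset.inl_mem_disjSum, hRw]
        rw [hvl] at hdj
        exact mem_filter.2 ⟨mem_univ _, hdj⟩
      · rw [Finset.inr_mem_disjSum, List.mem_toFinset]
        exact (hIr l).1 hjI
    have hanti : ∏ j ∈ Rw.disjSum π.toFinset, (1 - x j)
        ≤ ∏ j ∈ I.filter (fun j => j ≠ i ∧ ¬ Disjoint (vbl i) (vbl j)), (1 - x j) :=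
      prod_le_prod_of_subset_of_unit hsubG (fun j _ => sub_nonneg.2 (hx1 j))
        fun j _ => sub_le_self _ (hx0 j)
    have hGprod : ∏ j ∈ Rw.disjSum π.toFinset, (1 - x j)
        = (1 - xR) ^ Rw.card * (1 - xL) ^ π.toFinset.card := by
      rw [Finset.prod_disjSum]
      simp only [hxl, hxr, prod_const]
    -- the two factors
    have hRwle : Rw.card ≤ (vbl i).card * Δ := by rw [hRw]; exact hrows (vbl i)
    have hf1 : (1 - xR) ^ ((vbl i).card * Δ) ≤ (1 - xR) ^ Rw.card :=
      pow_le_pow_of_le_one h1xR (by linarith) hRwle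
    have hTcard : π.toFinset.card ≤ S := by rw [hSdef]; exact List.toFinset_card_le π
    have hf2 : (1 : ℝ) / 2 ≤ (1 - xL) ^ π.toFinset.card :=
      le_trans hxLS (pow_le_pow_of_le_one h1xL (by linarith) hTcard)
    calc (1 - xR) ^ ((vbl i).card * Δ) * (1 / 2)
        ≤ (1 - xR) ^ Rw.card * (1 - xL) ^ π.toFinset.card :=
          mul_le_mul hf1 hf2 (by norm_num) (pow_nonneg h1xR _)
      _ = ∏ j ∈ Rw.disjSum π.toFinset, (1 - x j) := hGprod.symm
      _ ≤ _ := hanti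
  /- 4. The probability bounds required by the local lemma. -/
  have hp : ∀ i ∈ I, ((A i).card : ℝ) ≤ x i *
      (∏ j ∈ I.filter (fun j => j ≠ i ∧ ¬ Disjoint (vbl i) (vbl j)), (1 - x j)) * N := by
    intro i hi
    have hpr := hprod i hi
    have hpr0 : 0 ≤ ∏ j ∈ I.filter (fun j => j ≠ i ∧ ¬ Disjoint (vbl i) (vbl j)), (1 - x j) :=
      prod_nonneg fun j _ => sub_nonneg.2 (hx1 j)
    rcases i with k | l
    · -- a row: overload probability `≤ 2^ℓ/(K+1)^{L+1} ≤ xR · 3/8 ≤ xR · ∏`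
      rw [hxl]
      have hov := card_overload_pi_le (K := K) (L := L) ((E k).supp) (hsparse k) (A (Sum.inl k))
        fun ω hω => (hmemAl k ω).1 hω
      rw [← hNdef] at hov
      have hsuppΔ : (vbl (Sum.inl k)).card * Δ ≤ ℓ * Δ := by
        rw [hvl]; exact Nat.mul_le_mul_right _ (hsparse k)
      have h1 : (1 - xR) ^ (ℓ * Δ) ≤ (1 - xR) ^ ((vbl (Sum.inl k)).card * Δ) :=
        pow_le_pow_of_le_one h1xR (by linarith) hsuppΔ
      have hpr' : (3 : ℝ) / 8
          ≤ ∏ j ∈ I.filter (fun j => j ≠ Sum.inl k ∧ ¬ Disjoint (vbl (Sum.inl k)) (vbl j)),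
              (1 - x j) := by
        linarith [hrow34, h1, hpr]
      have hcardle : ((A (Sum.inl k)).card : ℝ) ≤ 3 / 8 * xR * N := by
        refine le_of_mul_le_mul_right ?_ hKL
        calc ((A (Sum.inl k)).card : ℝ) * ((K : ℝ) + 1) ^ (L + 1) ≤ (2 : ℝ) ^ ℓ * N := hov
          _ ≤ 3 / 8 * xR * ((K : ℝ) + 1) ^ (L + 1) * N :=
              mul_le_mul_of_nonneg_right hkey hNpos.le
          _ = 3 / 8 * xR * N * ((K : ℝ) + 1) ^ (L + 1) := by ring
      calc ((A (Sum.inl k)).card : ℝ) ≤ 3 / 8 * xR * N := hcardle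
        _ = xR * (3 / 8) * N := by ring
        _ ≤ xR * (∏ j ∈ I.filter (fun j => j ≠ Sum.inl k ∧
              ¬ Disjoint (vbl (Sum.inl k)) (vbl j)), (1 - x j)) * N :=
            mul_le_mul_of_nonneg_right (mul_le_mul_of_nonneg_left hpr' hxR0.le) hNpos.le
    · -- a line on `v` variables
      rw [hxr]
      obtain ⟨v, hv⟩ : ∃ t : ℕ, t = (Vars l.clause).card := ⟨_, rfl⟩
      have hvv : (vbl (Sum.inr l)).card = v := by rw [hvr, hv]
      rw [hvv] at hpr
      by_cases hvW : 2 * v ≤ W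
      · -- narrow lines are never wide: the event is empty
        have hempty : A (Sum.inr l) = ∅ := by
          rw [Finset.eq_empty_iff_forall_notMem]
          intro ω hω
          have h := ((hmemAr l ω).1 hω).2
          have hlt := lt_two_mul_card_vars l.clause (ρ ω) (hρ_out ω) h
          have hlt' : W < 2 * v := by rw [hv, hVars]; exact hlt
          omega
        rw [hempty, card_empty, Nat.cast_zero]
        exact mul_nonneg (mul_nonneg hxL0.le hpr0) hNpos.le
      · -- wide lines: `|A| ≤ a^v N ≤ xL (b^v/2) N ≤ xL ∏ N`
        have hvq : W / 2 + 1 ≤ v := by omega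
        have hun := card_unsat_pi_le (K := K) l.clause (A (Sum.inr l))
          fun ω hω => ((hmemAr l ω).1 hω).1
        rw [← hNdef] at hun
        have hun' : ((A (Sum.inr l)).card : ℝ) ≤ ((2 * (K : ℝ) + 1) / (2 * K + 2)) ^ v * N := by
          rw [hv, hVars]; exact hun
        have hbv : b ^ v * (1 / 2)
            ≤ ∏ j ∈ I.filter (fun j => j ≠ Sum.inr l ∧ ¬ Disjoint (vbl (Sum.inr l)) (vbl j)),
                (1 - x j) := by
          have h1 : b ^ v ≤ (1 - xR) ^ (v * Δ) := by
            rw [show v * Δ = Δ * v from mul_comm _ _, pow_mul]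
            exact pow_le_pow_left₀ hb0.le hbΔ v
          exact le_trans (mul_le_mul_of_nonneg_right h1 (by norm_num)) hpr
        calc ((A (Sum.inr l)).card : ℝ) ≤ ((2 * (K : ℝ) + 1) / (2 * K + 2)) ^ v * N := hun'
          _ ≤ xL * (b ^ v * (1 / 2)) * N := mul_le_mul_of_nonneg_right (hline v hvq) hNpos.le
          _ ≤ xL * (∏ j ∈ I.filter (fun j => j ≠ Sum.inr l ∧
                ¬ Disjoint (vbl (Sum.inr l)) (vbl j)), (1 - x j)) * N :=
              mul_le_mul_of_nonneg_right (mul_le_mul_of_nonneg_left hbv hxL0.le) hNpos.le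
  /- 5. The local lemma: a sample point in no bad event. -/
  obtain ⟨ω, hω⟩ := exists_forall_not_mem_of_variable I A vbl hdet x hx0 hx1 hxI
    (by rw [hNdef] at hp; exact hp)
  -- its restriction has all loads `≤ L` …
  obtain ⟨Aset, hAset⟩ : ∃ T : Finset ℕ,
      T = ((univ : Finset (Fin n)).filter fun j => (ω j).1 = 0).map Fin.valEmbedding := ⟨_, rfl⟩
  have hload : ∀ k ∈ (univ : Finset (Fin m)), ((rowVars E k) ∩ Aset).card ≤ L := by
    intro k _
    have hnot := hω (Sum.inl k) (hIl k)
    rw [hmemAl, not_le] at hnot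
    have hle' := card_rowVars_inter_le E k (K := K) (fun j => (ω j).1)
    rw [hAset]
    exact Nat.lt_succ_iff.1 (lt_of_le_of_lt hle' hnot)
  have hρA : ∀ v, v < n → v ∉ Aset → ρ ω v = none := by
    intro v hv hvA
    simp only [hρ, hv, ↓reduceDIte]
    split_ifs with h0
    · refine absurd ?_ hvA
      rw [hAset]
      exact mem_map.2 ⟨⟨v, hv⟩, mem_filter.2 ⟨mem_univ _, h0⟩, rfl⟩
    · rfl
  -- … so some line is alive and wide: but that event was avoided
  have hU : ∀ l ∈ π, l.rule = ResRule.initial →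
      ∃ k ∈ (univ : Finset (Fin m)), ∃ cl ∈ equationCNF 1 (E k), cl.toFinset = l.clause := by
    intro l hl hrule
    obtain ⟨k, cl, hcl, hclC⟩ := exists_row_of_initial E hπ hl hrule
    exact ⟨k, mem_univ _, cl, hcl, hclC⟩
  obtain ⟨l, hl, hns, hwide⟩ :=
    exists_unsatisfied_wide_line E hexp hr hcL hW hπ hU hload (ρ ω) hρA
  have hnot := hω (Sum.inr l) ((hIr l).2 hl)
  rw [hmemAr, not_and, not_lt] at hnot
  exact absurd hwide (not_lt.2 (hnot hns))

end Summit.PneNP.PneNP.Theorems.ResNFree
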